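import Summits.BirchSwinnertonDyer.BirchSwinnertonDyer.Theorems.InertBadSignedBranchesCccOneLawOnTypeIstarZeroWitness
import Literature.NumberTheory.EllipticCurves.ManinConstantConductorLe300000
import HarnessLib

/-!
# Route `InertBadSignedBranches` (rung K8), crux `CccOneLawOnTypeIstarZero` (stmt-BirchSwinnertonDyer-19223):
# the MANIN DATUM of the per-pair equivalence «C-cc-1 ⟺ lower half» on the WIDENED Cremona range
# `N ≤ 300000`, and on the combined honest range «`7 < p` or `N ≤ 300000`»

Cell `b2b-bsdres`, unit `b2b-bsdres-x1b` (X12 prover owner, gen 47; ladder claim BSD:K8, the C-cc-1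
lineage). HONEST FRAMING (verbatim in every file of the cell): the cell DELETES the combination-shaped
residual classes of the BSD formula in analytic rank `≤ 1` from PUBLISHED theorems only and TYPES the
construction-shaped ones; class X12 / O10 is CONSTRUCTION-SHAPED and stays so; tool theorems only,
CONDITIONAL on every displayed hypothesis; nothing here is booked; no label moves.

WHAT THIS FILE DOES. In the per-pair equivalence «C-cc-1 at `(W, p)` ⟺ `MissingLowerBoundAt W p`»
(seat bsd-cm-inert g11, `…CccOneLawOnTypeIstarZeroWitness.lean` §3) the ONLY datum beyond the route's
own support items `h₅ = PrintReadingsInert`, `h₆ = PublishedFactsInert` and the published facts of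
route T-KR is the MANIN DATUM of the Kolyvagin (upper) half: discharged class-wide at `p ≥ 11` by
Edixhoven 1991 Thm. 3 + Deuring (`…_of_seven_lt`), and at `p ∈ {5, 7}` so far only on Cremona's
PRINTED range `N ≤ 130000` (Agashe–Ribet–Stein 2006 Thm. 2.6, `…_of_conductorNorm_le`). The tree
meanwhile holds the SAME sentence at the bound `300000` — the named fact
`Literature.NumberTheory.EllipticCurves.cremona_abs_maninConstant_eq_one_of_level_le_300000`
(`Literature/…/ManinConstantConductorLe300000.lean`: Cremona's verification `c = 1` for every
`Γ₀(N)`-optimal curve of conductor `≤ 300000`, as cited in print by Česnavičius–Neururer–Saha, JEMS 26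
(2024) §1, [Cre19]). This file re-runs x1b's every-curve upper half (gen 19,
`X12/InertCoreEveryCurveCremona.lean`) on that fact and states every consumer on the COMBINED range
«`7 < p ∨ N_W ≤ 300000`», which is the honest range of the Manin datum in the tree today:
* §1 `missingUpperBoundAt_of_classX12_of_not_cmRamified_of_conductorNorm_le_300000` — the upper half
  `ord_p #Ш(W) ≤ ord_p #Ш(W)_an` for EVERY globally minimal `W` with `ClassX12 W p`, `5 ≤ p`,
  `p ∤ d_K`, `N_W ≤ 300000` (Modularity supplies the unidentified optimal member `W₀ ∼ W` of the same
  conductor, Cremona-300000 its `p ∤ c`, gen 9's Kolyvagin–Gross–Zagier half applies to `W₀`,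
  Cassels moves it to `W`); `…_of_seven_lt_or_conductorNorm_le` — the same on «`7 < p ∨ N ≤ 300000`»
  for the inert core (`¬CMSplit`), gluing Edixhoven's branch (`X12.missingUpperBoundAt_of_classX12_of_cmInert`);
  `bsdp_iff_missingLowerBoundAt_…`, `bsdp_…_of_shaAn_unit` (route T-KR) on the combined range.
* §2 (the K8 crux, per pair) `quadraticBranchPAdicGrossZagierValuationAt_iff_missingLowerBoundAt_of_seven_lt_or_conductorNorm_le`
  — for `W` of signed type `(p, I₀*)`, `r_an(W) = 1`, `5 ≤ p`, and «`7 < p ∨ N_W ≤ 300000`»: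
  C-cc-1 at `(W, p)` ⟺ `MissingLowerBoundAt W p`, modulo `h₅ h₆` + the T-KR facts + `hEdx hDeu h300`;
  `…_of_shaAn_unit_…` — C-cc-1 at the pair from a certified `p`-adic unit `#Ш(W)_an`.
READING (no label change): on the O10-PS census `N < 5·10⁵` the per-pair iff now carries NO Manin
datum except on the cells with `p ∈ {5, 7}` AND `300000 < N < 500000`; the CLASS-level statement at
`p ∈ {5, 7}` still wants the Mazur–Stevens `I₀*` twist theorem (Stevens, Invent. Math. 98 (1989);
Edixhoven 1991, remark after Thm. 3), whose text the hub does not hold (acq-06513).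

References: J. E. Cremona, *Manin constants and optimal curves*, `ecdata/manin.txt` [Cre19], as cited by
K. Česnavičius, M. Neururer, A. Saha, JEMS 26 (2024) §1; A. Agashe, K. Ribet, W. Stein, PAMQ 2 (2006)
Thm. 2.6; B. Edixhoven, Progr. Math. 89 (1991) Thm. 3; A. Matar, J. Nekovář, JTNB 31 (2019) Thm. 0.3;
J. S. Milne, *ADT* I.7.3 (Cassels); HOME `b2b-bsdres-x1b/X12-ROUTE.md` §51.
-/

set_option autoImplicit false
set_option linter.dupNamespace false

noncomputable section

open scoped Classical MatrixGroups ModularForm NumberField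

open CongruenceSubgroup Field WeierstrassCurve NumberField
open Literature.NumberTheory.EllipticCurves
open Literature.NumberTheory.EllipticCurves.ModularForms
open Literature.NumberTheory.EllipticCurves.Rank1Residual
open Literature.NumberTheory.EllipticCurves.Rank1Residual.Typed
open Literature.NumberTheory.EllipticCurves.AgasheRibetStein2006
open Literature.NumberTheory.EllipticCurves.Wuthrich2014
open Summit.BirchSwinnertonDyer.Rank1Residual
open Summit.BirchSwinnertonDyer.Rank1Residual.Additive
open Summit.BirchSwinnertonDyer.Rank1Residual.X12.O10

namespace Summit.BirchSwinnertonDyer.BirchSwinnertonDyer.Theorems.CccOneManinRange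

/-! ## §1 The every-curve upper half on Cremona's range `N ≤ 300000`, and on «`7 < p ∨ N ≤ 300000`» -/

section UpperHalf

variable (W : WeierstrassCurve ℚ) [W.IsElliptic] [W.IsGloballyMinimal] (p : ℕ) [hp : Fact p.Prime]

/-- **X12, `p ≥ 5`, `p ∤ d_K`, conductor `≤ 300000`, EVERY CURVE: the upper half of `BSD(E,p)` from
published facts alone.** For every globally minimal `W/ℚ` of conductor `≤ 300000` with `ClassX12 W p`,
`5 ≤ p`, `¬CMRamified W p`: `MissingUpperBoundAt W p`. x1b gen 19's
`X12.missingUpperBoundAt_of_classX12_of_not_cmRamified_of_conductorNorm_le` with its Manin binder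
(ARS06 Thm. 2.6, `N ≤ 130000`) replaced by Cremona's verification at `N ≤ 300000` (`h300`): Modularity
supplies an optimal member `W₀ ∼ W` of the same conductor (`X12.exists_isIsogenous_optimal`), `h300`
gives `p ∤ c(D₀)` (`not_dvd_maninConstant_of_level_le_300000`), gen 9's Kolyvagin–Gross–Zagier half
applies to `W₀`, and Cassels (`hCassels`) moves it to `W`. CONDITIONAL; nothing booked.
[cite: CesnaviciusNeururerSaha2023, §1 (text chunk 3 L70–72) and bibliography entry Cre19]
[cite: MatarNekovar2019, Thm. 0.3 and §0.11] [cite: MilneADT2006, Thm. I.7.3 and Remark I.7.4] -/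
theorem missingUpperBoundAt_of_classX12_of_not_cmRamified_of_conductorNorm_le_300000
    (hGZ : ∀ (N : ℕ) [NeZero N] (W : WeierstrassCurve ℚ) (K : Type) [Field K] [NumberField K],
      gross_zagier N W K)
    (hKo : ∀ (N : ℕ) [NeZero N] (W : WeierstrassCurve ℚ) (K : Type) [Field K] [NumberField K],
      kolyvagin N W K)
    (hMN : ∀ (N : ℕ) [NeZero N] (W : WeierstrassCurve ℚ) (K : Type) [Field K] [NumberField K],
      MatarNekovar2019.thm03_padicValNat_card_sha_le_of_irreducible N W K)
    (hGZK : rank_eq_analyticRank_of_analyticRank_le_one) (hmod : hasEntireLFunction_rat)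
    (hnf : exists_isNewformOf) (hFH : friedbergHoffstein_exists_heegnerField_split_twist_ne_zero)
    (hCM8 : bsdTriple_of_hasCM_of_L_one_ne_zero)
    (h300 : cremona_abs_maninConstant_eq_one_of_level_le_300000)
    (hCassels : bsdRHS_eq_of_isIsogenous)
    (hX : ClassX12 W p) (hp5 : 5 ≤ p) (hnr : ¬ CMRamified W p) (hN : W.conductorNorm ℤ ≤ 300000) :
    MissingUpperBoundAt W p := by
  obtain ⟨W₀, hE₀, hM₀, hN₀, D₀, hiso, hNeq, hopt⟩ := X12.exists_isIsogenous_optimal hnf W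
  have hX₀ : ClassX12 W₀ p := (X12.classX12_iff_of_isIsogenous hiso p).mp hX
  have hnr₀ : ¬ CMRamified W₀ p :=
    fun h ↦ hnr ((X12.cmRamified_iff_of_isIsogenous hiso hX.1 p).mpr h)
  have hc : ¬ (p : ℤ) ∣ D₀.c :=
    not_dvd_maninConstant_of_level_le_300000 h300 W₀ D₀ hopt (by rw [hNeq]; exact hN) hp.out
  have hup₀ : MissingUpperBoundAt W₀ p :=
    X12.missingUpperBoundAt_of_classX12_of_not_cmRamified' hGZ hKo hMN hGZK hmod hnf hFH hCM8 W₀ p hX₀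
      hp5 hnr₀ D₀ hc
  exact X12.missingUpperBoundAt_of_isIsogenous hCassels hiso (hGZK W₀ (by rw [hX₀.2.1])).2
    (W₀.leadingLCoeff_ne_zero_holds (hmod W₀)) hup₀

/-- **THE COMBINED HONEST RANGE of the Manin datum on the X12 inert-bad core: «`7 < p` or
`N_W ≤ 300000`».** For every globally minimal `W/ℚ` with `ClassX12 W p`, `5 ≤ p`, `p` unramified and
non-split in the CM field, and `7 < p ∨ N_W ≤ 300000`: `MissingUpperBoundAt W p` — Edixhoven 1991
Thm. 3 + Deuring on the first branch (`X12.missingUpperBoundAt_of_classX12_of_cmInert`, x1b gen 19),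
Cremona-300000 on the second. CONDITIONAL; nothing booked.
[cite: EdixhovenManin1991, Thm. 3] [cite: CesnaviciusNeururerSaha2023, §1 (text chunk 3 L70–72)]
[cite: MatarNekovar2019, Thm. 0.3 and §0.11] -/
theorem missingUpperBoundAt_of_classX12_of_cmInert_of_seven_lt_or_conductorNorm_le
    (hGZ : ∀ (N : ℕ) [NeZero N] (W : WeierstrassCurve ℚ) (K : Type) [Field K] [NumberField K],
      gross_zagier N W K)
    (hKo : ∀ (N : ℕ) [NeZero N] (W : WeierstrassCurve ℚ) (K : Type) [Field K] [NumberField K],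
      kolyvagin N W K)
    (hMN : ∀ (N : ℕ) [NeZero N] (W : WeierstrassCurve ℚ) (K : Type) [Field K] [NumberField K],
      MatarNekovar2019.thm03_padicValNat_card_sha_le_of_irreducible N W K)
    (hGZK : rank_eq_analyticRank_of_analyticRank_le_one) (hmod : hasEntireLFunction_rat)
    (hnf : exists_isNewformOf) (hFH : friedbergHoffstein_exists_heegnerField_split_twist_ne_zero)
    (hCM8 : bsdTriple_of_hasCM_of_L_one_ne_zero)
    (hEdx : edixhoven_not_dvd_maninConstant_of_not_potentiallyGoodOrdinary)
    (hDeu : deuring_not_hasUnitRootAt_of_hasCM_of_not_cmSplit)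
    (h300 : cremona_abs_maninConstant_eq_one_of_level_le_300000)
    (hCassels : bsdRHS_eq_of_isIsogenous)
    (hX : ClassX12 W p) (hp5 : 5 ≤ p) (hnr : ¬ CMRamified W p) (hns : ¬ CMSplit W p)
    (hrange : 7 < p ∨ W.conductorNorm ℤ ≤ 300000) :
    MissingUpperBoundAt W p := by
  rcases hrange with hp7 | hN
  · exact X12.missingUpperBoundAt_of_classX12_of_cmInert hGZ hKo hMN hGZK hmod hnf hFH hCM8 hEdx hDeu
      hCassels W p hX hp7 hnr hns
  · exact missingUpperBoundAt_of_classX12_of_not_cmRamified_of_conductorNorm_le_300000 W p hGZ hKo hMN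
      hGZK hmod hnf hFH hCM8 h300 hCassels hX hp5 hnr hN

/-- **`BSD(E,p) ⟺ MissingLowerBoundAt W p`** on the inert-bad core, `5 ≤ p`, «`7 < p ∨ N_W ≤ 300000`»,
for EVERY curve (forward: bookkeeping; backward: lower + the upper half above). CONDITIONAL; nothing booked.
[cite: EdixhovenManin1991, Thm. 3] [cite: CesnaviciusNeururerSaha2023, §1 (text chunk 3 L70–72)]
[cite: Miller2011LMS, §1 and Def. 1.1] -/
theorem bsdp_iff_missingLowerBoundAt_of_classX12_of_cmInert_of_seven_lt_or_conductorNorm_le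
    (hGZ : ∀ (N : ℕ) [NeZero N] (W : WeierstrassCurve ℚ) (K : Type) [Field K] [NumberField K],
      gross_zagier N W K)
    (hKo : ∀ (N : ℕ) [NeZero N] (W : WeierstrassCurve ℚ) (K : Type) [Field K] [NumberField K],
      kolyvagin N W K)
    (hMN : ∀ (N : ℕ) [NeZero N] (W : WeierstrassCurve ℚ) (K : Type) [Field K] [NumberField K],
      MatarNekovar2019.thm03_padicValNat_card_sha_le_of_irreducible N W K)
    (hGZK : rank_eq_analyticRank_of_analyticRank_le_one) (hmod : hasEntireLFunction_rat)
    (hnf : exists_isNewformOf) (hFH : friedbergHoffstein_exists_heegnerField_split_twist_ne_zero)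
    (hCM8 : bsdTriple_of_hasCM_of_L_one_ne_zero)
    (hEdx : edixhoven_not_dvd_maninConstant_of_not_potentiallyGoodOrdinary)
    (hDeu : deuring_not_hasUnitRootAt_of_hasCM_of_not_cmSplit)
    (h300 : cremona_abs_maninConstant_eq_one_of_level_le_300000)
    (hCassels : bsdRHS_eq_of_isIsogenous)
    (hX : ClassX12 W p) (hp5 : 5 ≤ p) (hnr : ¬ CMRamified W p) (hns : ¬ CMSplit W p)
    (hrange : 7 < p ∨ W.conductorNorm ℤ ≤ 300000) :
    BSDp W p ↔ MissingLowerBoundAt W p := by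
  refine ⟨fun hb ↦ ?_, fun hlow ↦ ?_⟩
  · haveI : Finite W.sha := (hGZK W (by rw [hX.2.1])).2
    exact (lower_and_upper_of_missingPPartAt W p (missingPPartAt_of_bsdp W p hb)).1
  · exact bsdp_of_missingPPartAt W p hGZK (by rw [hX.2.1])
      (missingPPartAt_of_lower_of_upper W p hlow
        (missingUpperBoundAt_of_classX12_of_cmInert_of_seven_lt_or_conductorNorm_le W p hGZ hKo hMN hGZK
          hmod hnf hFH hCM8 hEdx hDeu h300 hCassels hX hp5 hnr hns hrange))

/-- **Route T-KR on the combined range**: `BSD(E,p)` on the inert-bad core, `5 ≤ p`,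
«`7 < p ∨ N_W ≤ 300000`», EVERY curve, from `r_an = 1` (inside `ClassX12`) and a certified `p`-adic unit
`#Ш(W)_an` alone. CONDITIONAL; nothing booked. [cite: EdixhovenManin1991, Thm. 3]
[cite: CesnaviciusNeururerSaha2023, §1 (text chunk 3 L70–72)] [cite: Miller2011LMS, §1 and Def. 1.1] -/
theorem bsdp_of_classX12_of_cmInert_of_seven_lt_or_conductorNorm_le_of_shaAn_unit
    (hGZ : ∀ (N : ℕ) [NeZero N] (W : WeierstrassCurve ℚ) (K : Type) [Field K] [NumberField K],
      gross_zagier N W K)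
    (hKo : ∀ (N : ℕ) [NeZero N] (W : WeierstrassCurve ℚ) (K : Type) [Field K] [NumberField K],
      kolyvagin N W K)
    (hMN : ∀ (N : ℕ) [NeZero N] (W : WeierstrassCurve ℚ) (K : Type) [Field K] [NumberField K],
      MatarNekovar2019.thm03_padicValNat_card_sha_le_of_irreducible N W K)
    (hGZK : rank_eq_analyticRank_of_analyticRank_le_one) (hmod : hasEntireLFunction_rat)
    (hnf : exists_isNewformOf) (hFH : friedbergHoffstein_exists_heegnerField_split_twist_ne_zero)
    (hCM8 : bsdTriple_of_hasCM_of_L_one_ne_zero)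
    (hEdx : edixhoven_not_dvd_maninConstant_of_not_potentiallyGoodOrdinary)
    (hDeu : deuring_not_hasUnitRootAt_of_hasCM_of_not_cmSplit)
    (h300 : cremona_abs_maninConstant_eq_one_of_level_le_300000)
    (hCassels : bsdRHS_eq_of_isIsogenous)
    (hX : ClassX12 W p) (hp5 : 5 ≤ p) (hnr : ¬ CMRamified W p) (hns : ¬ CMSplit W p)
    (hrange : 7 < p ∨ W.conductorNorm ℤ ≤ 300000)
    {q : ℚ} (hq : shaAn W = (q : ℂ)) (hv : padicValRat p q = 0) : BSDp W p :=
  (bsdp_iff_missingLowerBoundAt_of_classX12_of_cmInert_of_seven_lt_or_conductorNorm_le W p hGZ hKo hMN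
    hGZK hmod hnf hFH hCM8 hEdx hDeu h300 hCassels hX hp5 hnr hns hrange).mpr
    (X12.missingLowerBoundAt_of_shaAn_unit hq hv)

end UpperHalf

/-! ## §2 The K8 crux per pair on the combined range: C-cc-1 at `(W, p)` ⟺ the lower half at `(W, p)` -/

section CccOne

variable (W : WeierstrassCurve ℚ) [W.IsElliptic] [W.IsGloballyMinimal] (p : ℕ) [hp : Fact p.Prime]

/-- **Per pair, `5 ≤ p`, «`7 < p ∨ N_W ≤ 300000`»: C-cc-1 at `(W, p)` ⟺ `MissingLowerBoundAt W p`**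
(`ord_p #Ш(W)_an ≤ ord_p #Ш(W)`), for `W` of signed type `(p, I₀*)` with `r_an(W) = 1`, modulo the
route's support items `h₅ h₆`, the published facts of route T-KR, Edixhoven + Deuring (first branch) and
Cremona-300000 (second branch). Forward: C-cc-1 + (C1_η) + readings ⟹ `BSD(W, p)`
(`bsdp_of_hasSignedLocalType_IstarZero_of_valuation_of_readings`, the period datum from Mazur `h₆.hM`)
⟹ lower half; backward: lower + upper ⟹ `BSD(W, p)` ⟹ C-cc-1 (`…_of_bsdp_of_readings`, (C1_η) on the
CM inert twins). Supersedes, on its range, the seat bsd-cm-inert's `…_of_conductorNorm_le` (`N ≤ 130000`)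
and agrees with `…_of_seven_lt`. CONDITIONAL; nothing booked. [cite: EdixhovenManin1991, Thm. 3]
[cite: CesnaviciusNeururerSaha2023, §1 (text chunk 3 L70–72)] [cite: MatarNekovar2019, Thm. 0.3 and §0.11]
[cite: Miller2011LMS, §1 and Def. 1.1] -/
theorem quadraticBranchPAdicGrossZagierValuationAt_iff_missingLowerBoundAt_of_seven_lt_or_conductorNorm_le
    (h₅ : Summit.BirchSwinnertonDyer.BirchSwinnertonDyer.Theses.InertBadSignedBranches.PrintReadingsInert)
    (h₆ : Summit.BirchSwinnertonDyer.BirchSwinnertonDyer.Theses.InertBadSignedBranches.PublishedFactsInert)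
    (hGZ : ∀ (N : ℕ) [NeZero N] (W : WeierstrassCurve ℚ) (K : Type) [Field K] [NumberField K],
      gross_zagier N W K)
    (hKo : ∀ (N : ℕ) [NeZero N] (W : WeierstrassCurve ℚ) (K : Type) [Field K] [NumberField K],
      kolyvagin N W K)
    (hMN : ∀ (N : ℕ) [NeZero N] (W : WeierstrassCurve ℚ) (K : Type) [Field K] [NumberField K],
      MatarNekovar2019.thm03_padicValNat_card_sha_le_of_irreducible N W K)
    (hFH : friedbergHoffstein_exists_heegnerField_split_twist_ne_zero)
    (hCM8 : bsdTriple_of_hasCM_of_L_one_ne_zero)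
    (hEdx : edixhoven_not_dvd_maninConstant_of_not_potentiallyGoodOrdinary)
    (hDeu : deuring_not_hasUnitRootAt_of_hasCM_of_not_cmSplit)
    (h300 : cremona_abs_maninConstant_eq_one_of_level_le_300000)
    (hCassels : bsdRHS_eq_of_isIsogenous)
    (hp5 : 5 ≤ p) (hT : HasSignedLocalType W p (.Istar 0)) (hr : W.analyticRank = 1)
    (hrange : 7 < p ∨ W.conductorNorm ℤ ≤ 300000) :
    QuadraticBranchPAdicGrossZagierValuationAt W p ↔ MissingLowerBoundAt W p := by
  obtain ⟨hmod, hGZ', hGZK, hPT, hnf, hM⟩ := h₆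
  obtain ⟨hC1, hRd⟩ := h₅ p hp5
  obtain ⟨hR2, h74x⟩ := hRd W hT hr
  have key := bsdp_iff_missingLowerBoundAt_of_classX12_of_cmInert_of_seven_lt_or_conductorNorm_le W p hGZ
    hKo hMN hGZK hmod hnf hFH hCM8 hEdx hDeu h300 hCassels (classX12_of_hasSignedLocalType W p hT hr) hp5
    hT.2.1.1 hT.2.1.2 hrange
  refine ⟨fun h2 ↦ key.mp ?_, fun hlow ↦ ?_⟩
  · exact bsdp_of_hasSignedLocalType_IstarZero_of_valuation_of_readings hmod hGZ' hGZK hPT hnf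
      (periodRatio_of_mazur p hM hp5) hC1 W h2 hR2 h74x hT hr hp5
  · refine CccOneLowerHalf.quadraticBranchPAdicGrossZagierValuationAt_of_bsdp_of_readings W p hmod hGZK
      hPT (key.mpr hlow) hR2 h74x fun V _ _ C hC hgood hap ↦ ?_
    obtain ⟨hCM, hin⟩ := CccOneLowerHalf.hasCM_and_cmInert_of_twist W p hT C hC
    exact hC1 V hCM hgood hin

/-- **Per pair, `5 ≤ p`, «`7 < p ∨ N_W ≤ 300000`», `ord_p #Ш(W)_an = 0` certified: C-cc-1 at `(W, p)`**
(route T-KR on the combined range, then `…_of_bsdp_of_readings`) — covers every O10-PS census pair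
except those with `p ∈ {5, 7}` and `300000 < N_W`. PER PAIR; CONDITIONAL; nothing booked.
[cite: EdixhovenManin1991, Thm. 3] [cite: CesnaviciusNeururerSaha2023, §1 (text chunk 3 L70–72)]
[cite: MatarNekovar2019, Thm. 0.3 and §0.11] [cite: Miller2011LMS, §1 and Def. 1.1] -/
theorem quadraticBranchPAdicGrossZagierValuationAt_of_shaAn_unit_of_seven_lt_or_conductorNorm_le
    (h₅ : Summit.BirchSwinnertonDyer.BirchSwinnertonDyer.Theses.InertBadSignedBranches.PrintReadingsInert)
    (h₆ : Summit.BirchSwinnertonDyer.BirchSwinnertonDyer.Theses.InertBadSignedBranches.PublishedFactsInert)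
    (hGZ : ∀ (N : ℕ) [NeZero N] (W : WeierstrassCurve ℚ) (K : Type) [Field K] [NumberField K],
      gross_zagier N W K)
    (hKo : ∀ (N : ℕ) [NeZero N] (W : WeierstrassCurve ℚ) (K : Type) [Field K] [NumberField K],
      kolyvagin N W K)
    (hMN : ∀ (N : ℕ) [NeZero N] (W : WeierstrassCurve ℚ) (K : Type) [Field K] [NumberField K],
      MatarNekovar2019.thm03_padicValNat_card_sha_le_of_irreducible N W K)
    (hFH : friedbergHoffstein_exists_heegnerField_split_twist_ne_zero)
    (hCM8 : bsdTriple_of_hasCM_of_L_one_ne_zero)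
    (hEdx : edixhoven_not_dvd_maninConstant_of_not_potentiallyGoodOrdinary)
    (hDeu : deuring_not_hasUnitRootAt_of_hasCM_of_not_cmSplit)
    (h300 : cremona_abs_maninConstant_eq_one_of_level_le_300000)
    (hCassels : bsdRHS_eq_of_isIsogenous)
    (hp5 : 5 ≤ p) (hT : HasSignedLocalType W p (.Istar 0)) (hr : W.analyticRank = 1)
    (hrange : 7 < p ∨ W.conductorNorm ℤ ≤ 300000)
    {q : ℚ} (hq : shaAn W = (q : ℂ)) (hv : padicValRat p q = 0) :
    QuadraticBranchPAdicGrossZagierValuationAt W p :=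
  (quadraticBranchPAdicGrossZagierValuationAt_iff_missingLowerBoundAt_of_seven_lt_or_conductorNorm_le W p
    h₅ h₆ hGZ hKo hMN hFH hCM8 hEdx hDeu h300 hCassels hp5 hT hr hrange).mpr
    (X12.missingLowerBoundAt_of_shaAn_unit hq hv)

/-- **The old range implies the new**: the seat bsd-cm-inert's hypothesis set at `N ≤ 130000` is the
special case `N ≤ 130000 ≤ 300000` of §2 once Cremona-300000 replaces ARS06 Thm. 2.6 — recorded as
the implication between the two Manin binders (`cremona_abs_maninConstant_eq_one_of_level_le_of_le_300000`),
so that the registry carries ONE Manin sentence at two bounds, not two inputs. Bookkeeping.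
[cite: CesnaviciusNeururerSaha2023, §1 (text chunk 3 L70–72)] [cite: AgasheRibetStein2006, Thm. 2.6] -/
theorem cremona_le_130000_of_le_300000 (h300 : cremona_abs_maninConstant_eq_one_of_level_le_300000) :
    cremona_abs_maninConstant_eq_one_of_level_le :=
  cremona_abs_maninConstant_eq_one_of_level_le_of_le_300000 h300

end CccOne

end Summit.BirchSwinnertonDyer.BirchSwinnertonDyer.Theorems.CccOneManinRange

end
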